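import Mathlib
import Summits.Ventures.PercRepro2.K5Digits
import Summits.Ventures.PercRepro2.PMK5Deg3Kernel
import Summits.Ventures.PercRepro2.Deg3Kron
import Summits.Ventures.PercRepro2.PMK5Deg5Kernel
import Summits.Ventures.PercRepro2.PMK5Deg5Kernel6
import Summits.Ventures.PercRepro2.Deg5Kron6

/-!
# Bit-vector tables on nine edges and the index-carrying Kronecker tree in the base `2^28` (blind cell PercRepro2, mine-2 g29;
the literal bridge of the six-digit slice certificates of `PMK5Deg5Kernel6.lean`; mine-2 g28's `Deg4Bits5.lean` restated for the base `2^28`)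

* `idxLt2`, `goB_eq`, `bits9_eq_bitsSum`: the bit tree `goB` of the kernel file computes the bit sum
  `bitsSum T = Σ_ω [T ω] 2^{idx2 ω}` (the copy of `Deg3Kron.go_eq` with base `2` and weights `2^e`);
* `decode2`, `idx2_eq`, `decode2_idx2`, `idx2_lt`: the binary index of an nine-edge configuration and its inverse;
* **`bits9_testBit`**: bit `idx2 ω` of `bits9 T` is `T ω` (typer-1's `K5.digit_sum` in base `2`);
* `goL_eq`, **`kronL_eq`**: the index-carrying tree `goL L n i` is `go` of the table `s ↦ L.testBit (i + idx2 s)`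
  (induction on `n`, reindexing the `s n = true` half by `Function.update`), so `kronL L` is the Kronecker sum of
  the bit-vector table;
* **`kronL_bits9`**: `kronL (bits9 T) = kron T` — a correct table literal gives the table's Kronecker number;
  **`KL_eq`**: under `LitOK`, `KL L i a b c d e f = kron (res6 (tab i) a b c d e f)`.
-/

namespace Summit.Ventures.PercRepro2

namespace Deg5

namespace Six

/-! ## The bit tree is the bit sum -/

section BitTree

/-- The partial binary index: the states of the edges `< n`. -/
def idxLt2 (n : ℕ) (ω : Fin 9 → Bool) : ℕ :=
  ∑ e ∈ Finset.univ.filter (fun e : Fin 9 => (e : ℕ) < n), (ω e).toNat * 2 ^ (e : ℕ)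

/-- `idxLt2 (n+1)` splits off the edge `n`. -/
lemma idxLt2_succ {n : ℕ} (hn : n < 9) (s : Fin 9 → Bool) :
    idxLt2 (n + 1) s = idxLt2 n s + (s (Fin.ofNat 9 n)).toNat * 2 ^ n := by
  unfold idxLt2
  have hset : (Finset.univ.filter fun e : Fin 9 => (e : ℕ) < n + 1) =
      insert (Fin.ofNat 9 n) (Finset.univ.filter fun e : Fin 9 => (e : ℕ) < n) := by
    ext e
    simp only [Finset.mem_filter, Finset.mem_univ, true_and, Finset.mem_insert]
    constructor
    · intro h
      rcases Nat.lt_succ_iff_lt_or_eq.1 h with h | h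
      · exact Or.inr h
      · left; apply Fin.ext; rw [ofNat_val hn, h]
    · rintro (h | h)
      · rw [h, ofNat_val hn]; omega
      · omega
  rw [hset, Finset.sum_insert (by
    simp only [Finset.mem_filter, Finset.mem_univ, true_and, not_lt, ofNat_val hn, le_refl]),
    ofNat_val hn, add_comm]

/-- The invariant of the tree recursion: `goB T n ω` sums over the configurations agreeing with `ω`
on the edges `≥ n`, weighted by the partial index. -/
theorem goB_eq (T : (Fin 9 → Bool) → Bool) :
    ∀ (n : ℕ), n ≤ 9 → ∀ ω : Fin 9 → Bool,
      goB T n ω = ∑ s ∈ Finset.univ.filter (fun s => AgreeGe n ω s), (T s).toNat * 2 ^ idxLt2 n s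
  | 0, _, ω => by
    have hfil : (Finset.univ.filter fun s : Fin 9 → Bool => AgreeGe 0 ω s) = {ω} := by
      ext s
      simp only [Finset.mem_filter, Finset.mem_univ, true_and, Finset.mem_singleton, AgreeGe,
        Nat.zero_le, true_implies]
      exact ⟨fun h => funext h, fun h e => by rw [h]⟩
    rw [hfil, Finset.sum_singleton]
    simp [goB, idxLt2]
  | n + 1, hn, ω => by
    have hn' : n < 9 := by omega
    rw [goB, goB_eq T n (by omega), goB_eq T n (by omega)]
    -- split the target sum by the state of edge `n`
    rw [← Finset.sum_filter_add_sum_filter_not (Finset.univ.filter fun s => AgreeGe (n + 1) ω s)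
      (fun s : Fin 9 → Bool => s (Fin.ofNat 9 n) = true)]
    rw [Finset.filter_filter, Finset.filter_filter]
    have e0 : (Finset.univ.filter fun s : Fin 9 → Bool => AgreeGe (n + 1) ω s ∧
        ¬ s (Fin.ofNat 9 n) = true) =
        Finset.univ.filter fun s => AgreeGe n (Function.update ω (Fin.ofNat 9 n) false) s := by
      ext s
      simp only [Finset.mem_filter, Finset.mem_univ, true_and, AgreeGe, Bool.not_eq_true]
      constructor
      · rintro ⟨h, hs⟩ e he
        by_cases hen : e = Fin.ofNat 9 n
        · rw [hen, Function.update_self, hs]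
        · rw [Function.update_of_ne hen]
          refine h e ?_
          have : (e : ℕ) ≠ n := fun h' => hen (Fin.ext (by rw [ofNat_val hn', h']))
          omega
      · intro h
        refine ⟨fun e he => ?_, ?_⟩
        · have hen : e ≠ Fin.ofNat 9 n := fun h' => by
            rw [h', ofNat_val hn'] at he; omega
          rw [← Function.update_of_ne hen false ω]
          exact h e (by omega)
        · have := h (Fin.ofNat 9 n) (by rw [ofNat_val hn'])
          rwa [Function.update_self] at this
    have e1 : (Finset.univ.filter fun s : Fin 9 → Bool => AgreeGe (n + 1) ω s ∧
        s (Fin.ofNat 9 n) = true) =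
        Finset.univ.filter fun s => AgreeGe n (Function.update ω (Fin.ofNat 9 n) true) s := by
      ext s
      simp only [Finset.mem_filter, Finset.mem_univ, true_and, AgreeGe]
      constructor
      · rintro ⟨h, hs⟩ e he
        by_cases hen : e = Fin.ofNat 9 n
        · rw [hen, Function.update_self, hs]
        · rw [Function.update_of_ne hen]
          refine h e ?_
          have : (e : ℕ) ≠ n := fun h' => hen (Fin.ext (by rw [ofNat_val hn', h']))
          omega
      · intro h
        refine ⟨fun e he => ?_, ?_⟩
        · have hen : e ≠ Fin.ofNat 9 n := fun h' => by
            rw [h', ofNat_val hn'] at he; omega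
          rw [← Function.update_of_ne hen true ω]
          exact h e (by omega)
        · have := h (Fin.ofNat 9 n) (by rw [ofNat_val hn'])
          rwa [Function.update_self] at this
    rw [e0, e1, Finset.mul_sum, add_comm]
    congr 1
    · refine Finset.sum_congr rfl fun s hs => ?_
      rw [Finset.mem_filter] at hs
      have hsn : s (Fin.ofNat 9 n) = true := by
        have := hs.2 (Fin.ofNat 9 n) (by rw [ofNat_val hn'])
        rwa [Function.update_self] at this
      rw [idxLt2_succ hn', hsn, pow_add]
      simp only [Bool.toNat_true, one_mul]
      ring
    · refine Finset.sum_congr rfl fun s hs => ?_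
      rw [Finset.mem_filter] at hs
      have hsn : s (Fin.ofNat 9 n) = false := by
        have := hs.2 (Fin.ofNat 9 n) (by rw [ofNat_val hn'])
        rwa [Function.update_self] at this
      rw [idxLt2_succ hn', hsn]
      simp

/-- The partial index over all nine edges is the index. -/
lemma idxLt2_nine (s : Fin 9 → Bool) : idxLt2 9 s = idx2 s := by
  unfold idxLt2 idx2
  apply Finset.sum_congr
  · ext e
    simp only [Finset.mem_filter, Finset.mem_univ, true_and, iff_true]
    exact e.isLt
  · intros; rfl

/-- **The bit tree is the bit sum**: `bits9 T = bitsSum T`. -/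
theorem bits9_eq_bitsSum (T : (Fin 9 → Bool) → Bool) : bits9 T = bitsSum T := by
  unfold bits9 bitsSum
  rw [goB_eq T 9 le_rfl]
  have hfil : (Finset.univ.filter fun s : Fin 9 → Bool => AgreeGe 9 (fun _ => false) s) =
      Finset.univ := by
    ext s
    simp only [Finset.mem_filter, Finset.mem_univ, true_and, iff_true, AgreeGe]
    intro e he
    exact absurd he (by omega)
  rw [hfil]
  refine Finset.sum_congr rfl fun s _ => ?_
  rw [idxLt2_nine]

end BitTree

/-! ## Bits of the bit vector -/

section Bits

/-- Decoding a binary number into an nine-edge configuration. -/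
def decode2 (n : ℕ) : Fin 9 → Bool := fun i => n.testBit (i : ℕ)

/-- The binary index, written out. -/
lemma idx2_eq (ω : Fin 9 → Bool) : idx2 ω =
    (ω 0).toNat + 2 * (ω 1).toNat + 4 * (ω 2).toNat + 8 * (ω 3).toNat + 16 * (ω 4).toNat +
      32 * (ω 5).toNat + 64 * (ω 6).toNat + 128 * (ω 7).toNat + 256 * (ω 8).toNat := by
  simp only [idx2, Finset.sum_fin_eq_sum_range, Finset.sum_range_succ, Finset.sum_range_zero]
  simp
  ring

/-- The binary index is below `2^9`. -/
lemma idx2_lt (ω : Fin 9 → Bool) : idx2 ω < 512 := by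
  have h0 := Bool.toNat_le (ω 0)
  have h1 := Bool.toNat_le (ω 1)
  have h2 := Bool.toNat_le (ω 2)
  have h3 := Bool.toNat_le (ω 3)
  have h4 := Bool.toNat_le (ω 4)
  have h5 := Bool.toNat_le (ω 5)
  have h6 := Bool.toNat_le (ω 6)
  have h7 := Bool.toNat_le (ω 7)
  have h8 := Bool.toNat_le (ω 8)
  rw [idx2_eq]
  omega

/-- The binary index as a sum over `range 9`. -/
lemma idx2_eq_range (ω : Fin 9 → Bool) :
    idx2 ω = ∑ j ∈ Finset.range 9, (if h : j < 9 then (ω ⟨j, h⟩).toNat else 0) * 2 ^ j := by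
  unfold idx2
  rw [Finset.sum_fin_eq_sum_range]
  refine Finset.sum_congr rfl fun j _ => ?_
  split_ifs <;> simp

/-- Bit `i` of the binary index is the state of edge `i`. -/
lemma idx2_testBit (ω : Fin 9 → Bool) (i : Fin 9) : (idx2 ω).testBit i = ω i := by
  rw [Nat.testBit_eq_decide_div_mod_eq, idx2_eq_range]
  rw [K5.digit_sum (B := 2) (by norm_num) _ 9
    (fun j _ => by
      split_ifs
      exact Nat.lt_succ_of_le (Bool.toNat_le _)) i i.isLt]
  simp only [dif_pos i.isLt, Fin.eta]
  cases ω i <;> rfl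

/-- Decoding inverts the binary index. -/
lemma decode2_idx2 (ω : Fin 9 → Bool) : decode2 (idx2 ω) = ω := by
  funext i
  exact idx2_testBit ω i

/-- The binary index is injective. -/
lemma idx2_injective : Function.Injective idx2 := fun ω ω' h => by
  rw [← decode2_idx2 ω, ← decode2_idx2 ω', h]

/-- The binary index of a decoded number below `2^9` is the number. -/
lemma idx2_decode2 {n : ℕ} (hn : n < 512) : idx2 (decode2 n) = n := by
  rw [idx2_eq]
  unfold decode2
  simp only [Nat.testBit_eq_decide_div_mod_eq, Fin.val_zero, Fin.val_one]
  have tn : ∀ m : ℕ, (decide (m % 2 = 1)).toNat = m % 2 := by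
    intro m
    rcases Nat.mod_two_eq_zero_or_one m with h | h <;> simp [h]
  simp only [Nat.pow_zero, Nat.div_one, tn]
  show n % 2 + 2 * (n / 2 % 2) + 4 * (n / 4 % 2) + 8 * (n / 8 % 2) + 16 * (n / 16 % 2) + 32 * (n / 32 % 2) +
    64 * (n / 64 % 2) + 128 * (n / 128 % 2) + 256 * (n / 256 % 2) = n
  omega

/-- A sum over the configurations re-indexed over `range 512` through `decode2`. -/
lemma sum_configs_eq (c : (Fin 9 → Bool) → ℕ) :
    ∑ ω, c ω * 2 ^ idx2 ω = ∑ j ∈ Finset.range 512, c (decode2 j) * 2 ^ j := by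
  refine Finset.sum_nbij' idx2 decode2 (fun ω _ => Finset.mem_range.2 (idx2_lt ω))
    (fun j _ => Finset.mem_univ _) (fun ω _ => decode2_idx2 ω)
    (fun j hj => idx2_decode2 (Finset.mem_range.1 hj)) (fun ω _ => by rw [decode2_idx2])

/-- **Bit `idx2 ω` of the bit vector of `T` is `T ω`.** -/
theorem bits9_testBit (T : (Fin 9 → Bool) → Bool) (ω : Fin 9 → Bool) :
    (bits9 T).testBit (idx2 ω) = T ω := by
  rw [bits9_eq_bitsSum, Nat.testBit_eq_decide_div_mod_eq]
  unfold bitsSum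
  rw [sum_configs_eq]
  rw [K5.digit_sum (B := 2) (by norm_num) (fun j => (T (decode2 j)).toNat) 512
    (fun j _ => by cases T (decode2 j) <;> simp) (idx2 ω) (idx2_lt ω), decode2_idx2]
  cases T ω <;> rfl

end Bits

/-! ## The index-carrying tree -/

section Literal

/-- The binary index of the all-closed configuration is `0`. -/
lemma idx2_false : idx2 (fun _ : Fin 9 => false) = 0 := by simp [idx2]

/-- Opening the edge `n` (closed before) adds `2^n` to the binary index. -/
lemma idx2_update_true {n : ℕ} (hn : n < 9) (s : Fin 9 → Bool) (hs : s (Fin.ofNat 9 n) = false) :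
    idx2 (Function.update s (Fin.ofNat 9 n) true) = idx2 s + 2 ^ n := by
  unfold idx2
  rw [← Finset.sum_erase_add _ _ (Finset.mem_univ (Fin.ofNat 9 n)),
    ← Finset.sum_erase_add _ _ (Finset.mem_univ (Fin.ofNat 9 n))]
  rw [Function.update_self, hs, ofNat_val hn]
  simp only [Bool.toNat_true, Bool.toNat_false, one_mul, zero_mul, add_zero]
  congr 1
  refine Finset.sum_congr rfl fun e he => ?_
  rw [Function.update_of_ne (Finset.ne_of_mem_erase he)]

/-- The partial Kronecker index over the edges `< n` ignores the edge `n`. -/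
lemma idxLt_update {n : ℕ} (hn : n < 9) (s : Fin 9 → Bool) (b : Bool) :
    idxLt n (Function.update s (Fin.ofNat 9 n) b) = idxLt n s := by
  unfold idxLt
  refine Finset.sum_congr rfl fun e he => ?_
  rw [Finset.mem_filter] at he
  have hne : e ≠ Fin.ofNat 9 n := by
    intro h
    have := he.2
    rw [h, ofNat_val hn] at this
    omega
  rw [Function.update_of_ne hne]

/-- **The index-carrying tree is the configuration tree of the bit-vector table**: `goL L n i` is `go` of
`s ↦ L.testBit (i + idx2 s)` from the all-closed configuration. -/
theorem goL_eq (L : ℕ) : ∀ (n : ℕ), n ≤ 9 → ∀ i : ℕ,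
    goL L n i = go (fun s => L.testBit (i + idx2 s)) n (fun _ => false)
  | 0, _, i => by simp [goL, go, idx2_false]
  | n + 1, hn, i => by
    have hn' : n < 9 := by omega
    rw [goL, go, goL_eq L n (by omega) i, goL_eq L n (by omega) (i + 2 ^ n)]
    have h0 : Function.update (fun _ : Fin 9 => false) (Fin.ofNat 9 n) false = fun _ => false := by
      funext e
      by_cases h : e = Fin.ofNat 9 n
      · rw [h, Function.update_self]
      · rw [Function.update_of_ne h]
    rw [h0]
    have key : go (fun s => L.testBit (i + 2 ^ n + idx2 s)) n (fun _ => false) =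
        go (fun s => L.testBit (i + idx2 s)) n (Function.update (fun _ => false) (Fin.ofNat 9 n) true) := by
      rw [go_eq _ n (by omega), go_eq _ n (by omega)]
      refine Finset.sum_nbij' (fun s : Fin 9 → Bool => Function.update s (Fin.ofNat 9 n) true)
        (fun s : Fin 9 → Bool => Function.update s (Fin.ofNat 9 n) false) ?_ ?_ ?_ ?_ ?_
      · intro s hs
        simp only [Finset.mem_filter, Finset.mem_univ, true_and, AgreeGe] at hs ⊢
        intro e he
        by_cases h : e = Fin.ofNat 9 n
        · rw [h, Function.update_self, Function.update_self]
        · rw [Function.update_of_ne h, Function.update_of_ne h]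
          exact hs e he
      · intro s hs
        simp only [Finset.mem_filter, Finset.mem_univ, true_and, AgreeGe] at hs ⊢
        intro e he
        by_cases h : e = Fin.ofNat 9 n
        · rw [h, Function.update_self]
        · rw [Function.update_of_ne h]
          have := hs e he
          rwa [Function.update_of_ne h] at this
      · intro s hs
        simp only [Finset.mem_filter, Finset.mem_univ, true_and, AgreeGe] at hs
        funext e
        by_cases h : e = Fin.ofNat 9 n
        · rw [h, Function.update_self]
          exact (hs _ (by rw [ofNat_val hn'])).symm
        · rw [Function.update_of_ne h, Function.update_of_ne h]
      · intro s hs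
        simp only [Finset.mem_filter, Finset.mem_univ, true_and, AgreeGe] at hs
        funext e
        by_cases h : e = Fin.ofNat 9 n
        · rw [h, Function.update_self]
          have := hs _ (by rw [ofNat_val hn'])
          rw [Function.update_self] at this
          exact this.symm
        · rw [Function.update_of_ne h, Function.update_of_ne h]
      · intro s hs
        simp only [Finset.mem_filter, Finset.mem_univ, true_and, AgreeGe] at hs
        have hsn : s (Fin.ofNat 9 n) = false := hs _ (by rw [ofNat_val hn'])
        rw [idx2_update_true hn' s hsn, idxLt_update hn', show i + (idx2 s + 2 ^ n) = i + 2 ^ n + idx2 s by omega]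
    rw [key]

/-- **The Kronecker number of a bit-vector table**: `kronL L = kronSum (s ↦ L.testBit (idx2 s))`. -/
theorem kronL_eq (L : ℕ) : kronL L = kronSum fun s => L.testBit (idx2 s) := by
  rw [kronL_def, goL_eq L 9 le_rfl 0, ← kron_eq_kronSum]
  unfold kron
  simp only [zero_add]

/-- **A correct table literal gives the table's Kronecker number**: `kronL (bits9 T) = kron T`. -/
theorem kronL_bits9 (T : (Fin 9 → Bool) → Bool) : kronL (bits9 T) = kron T := by
  rw [kronL_eq, kron_eq_kronSum]
  unfold kronSum
  refine Finset.sum_congr rfl fun ω _ => ?_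
  simp only [bits9_testBit]

/-- Under `LitOK`, the literal Kronecker numbers are the restricted tables' Kronecker numbers. -/
theorem KL_eq {L : Fin 19 → Bool → Bool → Bool → Bool → Bool → Bool → ℕ} (hL : LitOK L)
    (i : Fin 19) (a b c d e f : Bool) : KL L i a b c d e f = kron (res6 (tab i) a b c d e f) := by
  unfold KL
  rw [hL i a b c d e f, kronL_bits9]

end Literal

end Six

end Deg5

end Summit.Ventures.PercRepro2
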